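import Summits.Ventures.LatticeQCDFlow.Scaling.UrnDeletionCoupling

/-!
HONEST FRAMING: exact (Metropolis-corrected) sampling algorithms for lattice gauge theory; figures
of merit are autocorrelation/cost numbers at stated couplings and volumes; no continuum-physics
claim.

# CompositionProductBracket — THE MULTIPLICATIVE ENVIRONMENT POTENTIAL `Ψ = Δ·Φ`, `Φ` AN AFFINE MASS OF THE JOINT COMPOSITION: ITS ONE-CYCLE BRACKET
# `E[Δ'Φ'] ≤ (Δ − G)(Φ + e) − Δ(R_X + R_Y) + 2 r_max·D⁺` FOR ANY COUPLING, AND THE CONTRACTION CRITERION `G(Φ + e − 2r_max) + Δ(R_X + R_Y − e) ≥ ρΔΦ` (lean-2 GEN-35, ours)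

Venture-side (OURS).  Cell `lqcd-flow` (pub-lqcd), unit `pub-lqcd-lean-2-g35`, 2026-08-29.  Chapter V (composition variables), file 5.  Files 2–3 showed that the composition
distance `Δ` alone contracts per refresh cycle by `1 − G/Δ`, with `G ≥ pΔ/min{Z_X,Z_Y}` for the urn — the conjectured order `p/(K+1)` except against a DOUBLE pool of
impersistent particles.  The toy of this generation (`lean-2/work-gen35/numerics/cyclehub.py`, NOTHING CLAIMED) says the pool is paid for by a MULTIPLICATIVE environment
term: `Ψ = Δ·Φ` with `Φ = c + s(z) + Σ_v r_v·(N_X(v) + N_Y(v))` an affine mass of the joint composition (additive masses `Δ + φ` decay with `K`).  This file is the exact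
one-cycle bookkeeping of such a product for ANY coupling `π` of the two deleted contents: after the deletions `(a,b)` and the common insertion the mass is
`Φ' = Φ + e − r_a − r_b` (`e` collects the state-independent expectations, e.g. `2·E_{μ_0} r + E_{μ_0} s − s(z)`), and with `D⁺ = E_π(Δ − Δ')⁺`, `G_π = Δ − E_π Δ'`,
`R_X = Σ_a u_X(a) r_a`, `R_Y = Σ_b u_Y(b) r_b`, `0 ≤ r ≤ r_max`:  `E_π[Δ'·Φ'] ≤ (Δ − G_π)(Φ + e) − Δ(R_X + R_Y) + 2 r_max D⁺`; for a monotone coupling (`Δ' ≤ Δ` on the support,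
e.g. the urn's optimal coupling, file 3) `D⁺ = G_π`, and `Ψ` contracts by `1 − ρ` as soon as `G_π(Φ + e − 2r_max) + Δ(R_X + R_Y − e) ≥ ρΔΦ` — the deletions' expected mass
`R_X + R_Y` against the insertions' `e`, with the distance gain `G_π` paying where the copies are clean.  Hypothesis-equations, no definitions, no chain.

## What is proved

* §1 `prod_next_mass_sum` (bookkeeping of `Σ π Δ'(Φ + e − r_a − r_b)`), **`product_bracket_le`** (the displayed inequality with `D⁺`), **`product_bracket_le_of_monotone`**
  (`Δ' ≤ Δ` on the support ⇒ `D⁺ = G_π`), **`product_contract_of_monotone`** (the contraction criterion ⇒ `E_π[Δ'Φ'] ≤ (1 − ρ)ΔΦ`).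
* §2 **`urn_product_bracket_le`** — the urn instance with the optimal coupling: `E[Δ'Φ'] ≤ (Δ − G)(Φ + e) − Δ(R_X + R_Y) + 2r_max·G`, `G` the gain of file 2 (`≥ pΔ/min{Z_X,Z_Y}`
  by file 3), together with `urn_product_contract` (criterion ⇒ contraction).

Reading (no numerics implied): the law-free choice of the weights `r`, `s` is the remaining mathematics of item 1 (i) in composition variables (toy: `r ≈ b` on the impersistent
contents, `≈ b/2` on the persistent ones for a 97 %-garbage hot law, per-cycle `κ ≈ 0.5–1.0` in units `(p/K)·min{1,τ}`, stable in `K`).  NOT CLAIMED: any choice of weights;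
anything measured.  Literature grade (cell rule): OWN, elementary; nothing cited as a fact; no new bib keys.
-/

open Finset
open Literature.Probability.MarkovChains

namespace Summit.Ventures.LatticeQCDFlow.Scaling

section Product
variable {S : Type*} [Fintype S] [DecidableEq S]

/-! ## §1 The product bracket for any coupling -/

omit [DecidableEq S] in
/-- Bookkeeping: `Σ π(a,b)·Δ'(a,b)·(Φ + e − r_a − r_b) = (Φ + e)·Σ π Δ' − Σ π Δ' r_a − Σ π Δ' r_b`. [ours] -/
theorem prod_next_mass_sum (π Dn : S → S → ℝ) (r : S → ℝ) (Φ e : ℝ) :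
    ∑ a, ∑ b, π a b * (Dn a b * (Φ + e - r a - r b))
      = (Φ + e) * ∑ a, ∑ b, π a b * Dn a b - ∑ a, ∑ b, π a b * Dn a b * r a - ∑ a, ∑ b, π a b * Dn a b * r b := by
  rw [mul_sum, ← sum_sub_distrib, ← sum_sub_distrib]
  refine sum_congr rfl fun a _ => ?_
  rw [mul_sum, ← sum_sub_distrib, ← sum_sub_distrib]
  refine sum_congr rfl fun b _ => ?_
  ring

omit [DecidableEq S] in
/-- **THE PRODUCT BRACKET FOR ANY COUPLING.**  `π ≥ 0` with row sums `u_X`, column sums `u_Y`; next distances `Δ'(a,b)`; weights `0 ≤ r ≤ r_max`.  Then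
`E_π[Δ'·(Φ + e − r_a − r_b)] ≤ (Δ − G_π)(Φ + e) − Δ·(R_X + R_Y) + 2 r_max·D⁺` with `G_π = Δ − E_π Δ'`, `D⁺ = E_π (Δ − Δ')⁺`, `R_X = Σ u_X r`, `R_Y = Σ u_Y r`. [ours] -/
theorem product_bracket_le (π Dn : S → S → ℝ) (uX uY r : S → ℝ) (D Φ e rmax : ℝ)
    (hπ0 : ∀ a b, 0 ≤ π a b) (hrow : ∀ a, ∑ b, π a b = uX a) (hcol : ∀ b, ∑ a, π a b = uY b)
    (hr0 : ∀ v, 0 ≤ r v) (hrmax : ∀ v, r v ≤ rmax) :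
    ∑ a, ∑ b, π a b * (Dn a b * (Φ + e - r a - r b))
      ≤ (D - (D - ∑ a, ∑ b, π a b * Dn a b)) * (Φ + e) - D * (∑ a, uX a * r a + ∑ b, uY b * r b)
        + 2 * rmax * ∑ a, ∑ b, π a b * max (D - Dn a b) 0 := by
  rw [prod_next_mass_sum]
  -- `Σ π Δ' r_a ≥ D·R_X − r_max·D⁺`
  have hA : D * ∑ a, uX a * r a - rmax * ∑ a, ∑ b, π a b * max (D - Dn a b) 0 ≤ ∑ a, ∑ b, π a b * Dn a b * r a := by
    have h1 : D * ∑ a, uX a * r a = ∑ a, ∑ b, π a b * D * r a := by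
      rw [mul_sum]
      refine sum_congr rfl fun a _ => ?_
      rw [← hrow a, sum_mul, mul_sum]
      refine sum_congr rfl fun b _ => ?_
      ring
    rw [h1, mul_sum, ← sum_sub_distrib]
    refine sum_le_sum fun a _ => ?_
    rw [mul_sum, ← sum_sub_distrib]
    refine sum_le_sum fun b _ => ?_
    have hπ := hπ0 a b
    have hm : (D - Dn a b) * r a ≤ max (D - Dn a b) 0 * rmax := by
      rcases le_total 0 (D - Dn a b) with h | h
      · rw [max_eq_left h]; exact mul_le_mul_of_nonneg_left (hrmax a) h
      · rw [max_eq_right h, zero_mul]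
        nlinarith [hr0 a, h]
    nlinarith [hm, hπ]
  have hB : D * ∑ b, uY b * r b - rmax * ∑ a, ∑ b, π a b * max (D - Dn a b) 0 ≤ ∑ a, ∑ b, π a b * Dn a b * r b := by
    have h1 : D * ∑ b, uY b * r b = ∑ a, ∑ b, π a b * D * r b := by
      rw [mul_sum, sum_comm]
      refine sum_congr rfl fun b _ => ?_
      rw [← hcol b, sum_mul, mul_sum]
      refine sum_congr rfl fun a _ => ?_
      ring
    rw [h1, mul_sum, ← sum_sub_distrib]
    refine sum_le_sum fun a _ => ?_
    rw [mul_sum, ← sum_sub_distrib]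
    refine sum_le_sum fun b _ => ?_
    have hπ := hπ0 a b
    have hm : (D - Dn a b) * r b ≤ max (D - Dn a b) 0 * rmax := by
      rcases le_total 0 (D - Dn a b) with h | h
      · rw [max_eq_left h]; exact mul_le_mul_of_nonneg_left (hrmax b) h
      · rw [max_eq_right h, zero_mul]; nlinarith [hr0 b, h]
    nlinarith [hm, hπ]
  have hG : (D - (D - ∑ a, ∑ b, π a b * Dn a b)) * (Φ + e) = (Φ + e) * ∑ a, ∑ b, π a b * Dn a b := by ring
  rw [hG]
  linarith

omit [DecidableEq S] in
/-- **Monotone couplings:** if `Δ' ≤ Δ` on the support of `π` then `D⁺ = G_π` and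
`E_π[Δ'Φ'] ≤ (Δ − G_π)(Φ + e) − Δ(R_X + R_Y) + 2 r_max G_π`. [ours] -/
theorem product_bracket_le_of_monotone (π Dn : S → S → ℝ) (uX uY r : S → ℝ) (D Φ e rmax : ℝ)
    (hπ0 : ∀ a b, 0 ≤ π a b) (hrow : ∀ a, ∑ b, π a b = uX a) (hcol : ∀ b, ∑ a, π a b = uY b) (htot : ∑ a, uX a = 1)
    (hr0 : ∀ v, 0 ≤ r v) (hrmax : ∀ v, r v ≤ rmax) (hmono : ∀ a b, π a b ≠ 0 → Dn a b ≤ D) :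
    ∑ a, ∑ b, π a b * (Dn a b * (Φ + e - r a - r b))
      ≤ (D - (D - ∑ a, ∑ b, π a b * Dn a b)) * (Φ + e) - D * (∑ a, uX a * r a + ∑ b, uY b * r b)
        + 2 * rmax * (D - ∑ a, ∑ b, π a b * Dn a b) := by
  have h := product_bracket_le π Dn uX uY r D Φ e rmax hπ0 hrow hcol hr0 hrmax
  have hD : ∑ a, ∑ b, π a b * max (D - Dn a b) 0 = D - ∑ a, ∑ b, π a b * Dn a b := by
    have h1 : ∑ a, ∑ b, π a b * max (D - Dn a b) 0 = ∑ a, ∑ b, (π a b * D - π a b * Dn a b) := by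
      refine sum_congr rfl fun a _ => sum_congr rfl fun b _ => ?_
      by_cases hz : π a b = 0
      · rw [hz]; ring
      · rw [max_eq_left (sub_nonneg.mpr (hmono a b hz))]; ring
    rw [h1]
    simp_rw [sum_sub_distrib]
    rw [show ∑ a, ∑ b, π a b * D = D by
      rw [show ∑ a, ∑ b, π a b * D = (∑ a, ∑ b, π a b) * D by rw [sum_mul]; exact sum_congr rfl fun a _ => by rw [sum_mul]]
      simp_rw [hrow]; rw [htot, one_mul]]
  rw [hD] at h
  exact h

omit [DecidableEq S] in
/-- **CONTRACTION CRITERION** (monotone coupling): if `G_π(Φ + e − 2 r_max) + Δ(R_X + R_Y − e) ≥ ρΔΦ` then `E_π[Δ'Φ'] ≤ (1 − ρ)·Δ·Φ`. [ours] -/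
theorem product_contract_of_monotone (π Dn : S → S → ℝ) (uX uY r : S → ℝ) (D Φ e rmax ρ : ℝ)
    (hπ0 : ∀ a b, 0 ≤ π a b) (hrow : ∀ a, ∑ b, π a b = uX a) (hcol : ∀ b, ∑ a, π a b = uY b) (htot : ∑ a, uX a = 1)
    (hr0 : ∀ v, 0 ≤ r v) (hrmax : ∀ v, r v ≤ rmax) (hmono : ∀ a b, π a b ≠ 0 → Dn a b ≤ D)
    (hcrit : ρ * D * Φ ≤ (D - ∑ a, ∑ b, π a b * Dn a b) * (Φ + e - 2 * rmax) + D * (∑ a, uX a * r a + ∑ b, uY b * r b - e)) :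
    ∑ a, ∑ b, π a b * (Dn a b * (Φ + e - r a - r b)) ≤ (1 - ρ) * D * Φ := by
  have h := product_bracket_le_of_monotone π Dn uX uY r D Φ e rmax hπ0 hrow hcol htot hr0 hrmax hmono
  nlinarith [h, hcrit]

/-! ## §2 The urn instance (optimal coupling, `τ = ∞`) -/

variable {Δ : (S → ℕ) → (S → ℕ) → ℕ} {W : S → ℝ} {p ZX ZY : ℝ} {NX NY : S → ℕ} {uX uY : S → ℝ}

/-- **THE URN'S PRODUCT BRACKET:** with the urn laws `u(v) = (N(v)/W(v))/Z` and the optimal coupling of the two deletions (monotone by file 3),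
`E[Δ'·(Φ + e − r_a − r_b)] ≤ (Δ − G)(Φ + e) − Δ(R_X + R_Y) + 2 r_max G`, where `G = Δ − E[Δ']` is the gain of file 2 (`≥ pΔ/min{Z_X,Z_Y}` by file 3). [ours] -/
theorem urn_product_bracket_le (hΔ : ∀ N N', Δ N N' = ∑ v, (N v - N' v)) (MX MY : S → S → ℕ) (hW : ∀ v, 0 < W v)
    (hZX : ZX = ∑ v, (NX v : ℝ) / W v) (hZY : ZY = ∑ v, (NY v : ℝ) / W v) (hZX0 : 0 < ZX) (hZY0 : 0 < ZY)
    (huX : ∀ v, uX v = (NX v : ℝ) / W v / ZX) (huY : ∀ v, uY v = (NY v : ℝ) / W v / ZY)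
    (hMX : ∀ a, uX a ≠ 0 → NX = MX a + Pi.single a 1) (hMY : ∀ b, uY b ≠ 0 → NY = MY b + Pi.single b 1)
    (r : S → ℝ) (Φ e rmax : ℝ) (hr0 : ∀ v, 0 ≤ r v) (hrmax : ∀ v, r v ≤ rmax) :
    ∑ a, ∑ b, optimalCoupling uX uY a b * ((Δ (MX a) (MY b) : ℝ) * (Φ + e - r a - r b))
      ≤ ((Δ NX NY : ℝ) - ((Δ NX NY : ℝ) - ∑ a, ∑ b, optimalCoupling uX uY a b * (Δ (MX a) (MY b) : ℝ))) * (Φ + e)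
        - (Δ NX NY : ℝ) * (∑ a, uX a * r a + ∑ b, uY b * r b)
        + 2 * rmax * ((Δ NX NY : ℝ) - ∑ a, ∑ b, optimalCoupling uX uY a b * (Δ (MX a) (MY b) : ℝ)) := by
  have hq := optimalCoupling_isCoupling (urn_law_nonneg hW hZX0 huX) (urn_law_nonneg hW hZY0 huY) (urn_law_sum_eq_one hZX hZX0 huX)
    (urn_law_sum_eq_one hZY hZY0 huY)
  exact product_bracket_le_of_monotone (optimalCoupling uX uY) (fun a b => (Δ (MX a) (MY b) : ℝ)) uX uY r (Δ NX NY : ℝ) Φ e rmax hq.1 hq.2.1 hq.2.2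
    (urn_law_sum_eq_one hZX hZX0 huX) hr0 hrmax (fun a b hab => by exact_mod_cast urn_monotone hΔ MX MY hW hZX0 hZY0 huX huY hMX hMY hab)

/-- **THE URN'S MULTIPLICATIVE CERTIFICATE, CONDITIONAL FORM:** if the weights satisfy `G(Φ + e − 2r_max) + Δ(R_X + R_Y − e) ≥ ρΔΦ` at the state, the product potential
contracts: `E[Δ'Φ'] ≤ (1 − ρ)ΔΦ`. [ours] -/
theorem urn_product_contract (hΔ : ∀ N N', Δ N N' = ∑ v, (N v - N' v)) (MX MY : S → S → ℕ) (hW : ∀ v, 0 < W v)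
    (hZX : ZX = ∑ v, (NX v : ℝ) / W v) (hZY : ZY = ∑ v, (NY v : ℝ) / W v) (hZX0 : 0 < ZX) (hZY0 : 0 < ZY)
    (huX : ∀ v, uX v = (NX v : ℝ) / W v / ZX) (huY : ∀ v, uY v = (NY v : ℝ) / W v / ZY)
    (hMX : ∀ a, uX a ≠ 0 → NX = MX a + Pi.single a 1) (hMY : ∀ b, uY b ≠ 0 → NY = MY b + Pi.single b 1)
    (r : S → ℝ) (Φ e rmax ρ : ℝ) (hr0 : ∀ v, 0 ≤ r v) (hrmax : ∀ v, r v ≤ rmax)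
    (hcrit : ρ * (Δ NX NY : ℝ) * Φ ≤ ((Δ NX NY : ℝ) - ∑ a, ∑ b, optimalCoupling uX uY a b * (Δ (MX a) (MY b) : ℝ)) * (Φ + e - 2 * rmax)
      + (Δ NX NY : ℝ) * (∑ a, uX a * r a + ∑ b, uY b * r b - e)) :
    ∑ a, ∑ b, optimalCoupling uX uY a b * ((Δ (MX a) (MY b) : ℝ) * (Φ + e - r a - r b)) ≤ (1 - ρ) * (Δ NX NY : ℝ) * Φ := by
  have hq := optimalCoupling_isCoupling (urn_law_nonneg hW hZX0 huX) (urn_law_nonneg hW hZY0 huY) (urn_law_sum_eq_one hZX hZX0 huX)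
    (urn_law_sum_eq_one hZY hZY0 huY)
  exact product_contract_of_monotone (optimalCoupling uX uY) (fun a b => (Δ (MX a) (MY b) : ℝ)) uX uY r (Δ NX NY : ℝ) Φ e rmax ρ hq.1 hq.2.1 hq.2.2
    (urn_law_sum_eq_one hZX hZX0 huX) hr0 hrmax (fun a b hab => by exact_mod_cast urn_monotone hΔ MX MY hW hZX0 hZY0 huX huY hMX hMY hab) hcrit

end Product

end Summit.Ventures.LatticeQCDFlow.Scaling
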